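/-
Copyright (c) 2026 the pub-hodgecm-mathlib formalisation cell (harness21).  Prover seat hodgecm-mathlib-K2E3-p11 (g7), Track B «K2-LIT» ∕ h413
(`stmt-HodgeConjecture-24833`), line `K2_E3_EllipticInputs`, road (11-3-split-nsc), leaf (nsc-S-A′) `sig_K2E3GL3PrincipalBlockStandardSpan` (architect K2E3-p25 (g2),
`MEMO-SA-architecture.v2` §1), dealer K2E3-plan (g4) D88, brick ONE-DIM: THE JACQUET EXPONENT OF THE ONE-DIMENSIONAL REPRESENTATION `η ∘ det` OF `GL₃(F)` AND ITS
EMBEDDING INTO THE PRINCIPAL SERIES `I(η ν⁻¹, η, η ν)`.  2026-09-04.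
-/
import Summits.HodgeConjecture.HodgeConjecture.Theorems.K2E3GL3PrincipalSeriesExponents   -- ★ H0-a (K2E3-p25): the `tch`∕`mult` currency, `det_fin_one_block`; brings ★ `K2E3GL3BorelModulus` (`rootDeltaChar_borel_three`, `det_coe_eq_prod_diag`)
import Summits.HodgeConjecture.HodgeConjecture.Theorems.K2E3JacquetExponentEigenvector     -- ★ E1b (K2E3-p25): `weightSpace_eq_top_of_forall_apply_eq_smul`, `weightSpace_eq_bot_of_forall_apply_eq_smul_of_ne`
import Literature.NumberTheory.Automorphic.TateLocalFactors                               -- ★ `unramifiedTwist` (`ν = ‖·‖^1`), `unramifiedTwist_apply`, `normAbs_units_ne_zero`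
import Literature.NumberTheory.Automorphic.SmoothCharacterOfCharacter                     -- ★ `isAdmissible_trivial_twist`, `isSmooth_trivial_twist`
import Literature.NumberTheory.Automorphic.ParabolicInductionProofs                       -- ★ `rootDeltaChar_eq_one_of_mem_unipotentRadicalP` (`δ_B^{1∕2}|_U = 1`)
import HarnessLib

/-!
# K2_E3 road (h413), leaf (nsc-S-A′), brick ONE-DIM: the one-dimensional representation `ρ_η = η ∘ det` of `GL₃(F)` — admissibility, its Jacquet module (a line with the
# single exponent `tch(η ν⁻¹, η, η ν)`, multiplicity one) and its embedding into the principal series `I(η ν⁻¹, η, η ν)`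

Cell `pub/hodgecm-mathlib` (D-0151), Track B, seat K2E3-p11 (g7); architect K2E3-p25 (g2) (`MEMO-SA-architecture.v2` §1 row ONE-DIM; consumer: case brick C2 «cube»,
`η′det₃ ↪ I ![a, aν, aν²]`), dealer K2E3-plan (g4) D88.  `--supports stmt-HodgeConjecture-24833 --as helper`; THEOREMS ONLY (no definition ∕ instance ∕ notation ∕ named
fact ∕ `sorry`); never imports `Cruxes/…/Lines`.  COUNT-NEUTRAL helper.

NOTATION (spelled out inline, CONVENTIONS 08:40Z of the leaf).  `F` a non-archimedean local field; `T = LB 3 := Π a : Fin 3, GL {i // id i = a} F` the diagonal torus,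
`B = standardParabolicGL F id`, `U_B = unipotentRadicalP F id`; `tch θ := ∏ a, (θ a) ∘ det ∘ ev_a : T →* ℂˣ` for `θ : Fin 3 → (Fˣ →* ℂˣ)`;
`I θ := parabolicIndGL F id (𝟙.twist (tch θ))`; `mult V ζ := finrank ℂ ↥(⨅ m, maxGenEigenspace (normalizedJacquetGL F id V m) (ζ m))` for `ζ : T → ℂ`;
`ν := (unramifiedTwist F 1).toMonoidHom` (`ν x = ‖x‖`, ★ `TateLocalFactors`); for `η : Fˣ →* ℂˣ`:  `ρ_η := (trivial ℂ (GL (Fin 3) F) ℂ).twist (η.comp det)` (the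
one-dimensional representation `g ↦ η(det g)`) and its EXPONENT TRIPLE `θ_η := ![η * ν⁻¹, η, η * ν]`.

THE MATHEMATICS [BernsteinZelevinsky1977, §2.3, Geometrical Lemma 2.12]; [Zelevinsky1980, §1.1, Prop. 1.10 (character `ν`), Ex. 3.2]; [Casselman1995, §3.1, §6.3]; [Bump1997, §4.5].
* §1 `ker (η ∘ det)` is open when `ker η` is (★ Mathlib `Matrix.GeneralLinearGroup.continuous_det`), so `ρ_η` is admissible (★ `isAdmissible_trivial_twist`).
* §2 **THE INDUCING CHARACTER OF `I θ_η` IS `η ∘ det` ON `B`**: `tch θ_η (proj b) · δ_B^{1∕2}(b) = η(det b)` (`tch_shift_leviProjection_mul_rootDeltaChar`) — `δ_B^{1∕2}(b) = ‖b₀₀‖‖b₂₂‖⁻¹`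
  (★ `rootDeltaChar_borel_three`), `det b = b₀₀ b₁₁ b₂₂` (★ `det_coe_eq_prod_diag`), `ν(b_aa) = ‖b_aa‖`; hence `η ∘ det` is trivial on `U_B`.
* §3 **THE JACQUET MODULE OF `ρ_η`**: `U_B` acts trivially on the line `ℂ`, so `r_B ρ_η = ℂ` (the coinvariant kernel is `⊥`; `finrank = 1`), and by ★ `normalizedJacquetGL_mk` and §2 at
  `b = diag m` the NORMALISED action of `m ∈ T` is the scalar `tch θ_η (m) = η(det m) δ_B^{-1∕2}(diag m)`; so **`mult ρ_η ζ = [ζ = ⇑tch θ_η]`** (★ E1b one-dimensional weight spaces).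
* §4 **EMBEDDING `ρ_η ↪ I θ_η`**: the identity `ℂ → ℂ` is a `B`-map `ρ_η|_B → σ_{θ_η} = (tch θ_η ∘ proj) · δ_B^{1∕2}` by §2, so Frobenius reciprocity (★ `Representation.frobeniusInv`,
  `(Φ v)(g) = η(det g) v`) gives a `GL₃(F)`-map `Φ : ρ_η → I θ_η`, injective by evaluation at `1`.  (Self-contained; the general EMB brick D86 is not used.)
HONEST LABEL: HC_CM is proved only modulo the 7 printed citations (2 remaining named inputs: hLiu418 = stmt-HodgeConjecture-24832, h413 = stmt-HodgeConjecture-24833)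
until rung 0 closes; count-neutral helper (structure theory of `GL₃(F)`; no printed citation is discharged).

## Mathlib ∕ tree search
Tree ★: H0-a `K2E3GL3PrincipalSeriesExponents.det_fin_one_block` · E1b `weightSpace_eq_top_of_forall_apply_eq_smul`∕`weightSpace_eq_bot_of_forall_apply_eq_smul_of_ne` · `K2E3GL3BorelModulus.rootDeltaChar_borel_three`∕
`det_coe_eq_prod_diag`∕`diag_ne_zero_of_mem_borel` · `unramifiedTwist_apply`, `normAbs_units_ne_zero` (TateLocalFactors) · `isAdmissible_trivial_twist`∕`isSmooth_trivial_twist` (SmoothCharacterOfCharacter) ·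
`rootDeltaChar_eq_one_of_mem_unipotentRadicalP` · `normalizedJacquetGL_mk`, `leviProjection_leviEmbeddingP_apply`, `leviProjection_apply_coe`, `coe_leviEmbeddingP` (ParabolicGL) ·
`Representation.frobeniusInv`∕`toFun_frobeniusInv_apply` (SmoothInduction) · `Representation.twist_apply` (MatrixCoefficients).  Mathlib: `Matrix.GeneralLinearGroup.continuous_det`,
`Representation.Coinvariants.mk`∕`mk_surjective`∕`Coinvariants.ker`, `Submodule.quotEquivOfEqBot`, `LinearMap.intertwiningMap_of_isIntertwiningMap`, `Complex.cpow_one`, `Fin.prod_univ_three`.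
Dedup: `rg "twist_det|CharacterJacquetExponent|tch_shift"` over `Literature Summits` — the `GL₂` analogue is inside ★ G2 `K2E3GL2ReducibleInducedDetCharConstituent` (`exists_line_detChar`, ad hoc);
no `GL₃`∕`tch`-currency statement exists.

## References
* [BernsteinZelevinsky1977] I. N. Bernstein, A. V. Zelevinsky, *Induced representations of reductive p-adic groups I*, Ann. Sci. ÉNS 10 (1977), §2.3, 2.12.
* [Zelevinsky1980] A. V. Zelevinsky, *Induced representations of reductive p-adic groups II*, Ann. Sci. ÉNS 13 (1980), §1.1, Prop. 1.10, Ex. 3.2.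
* [Casselman1995] W. Casselman, *Introduction to the theory of admissible representations of p-adic reductive groups* (1995 notes), §3.1 (Frobenius reciprocity), §6.3.
* [Bump1997] D. Bump, *Automorphic Forms and Representations* (1997), §4.2 (2.2)–(2.3), Prop. 4.5.1, Thm. 4.5.4.
-/

set_option autoImplicit false
-- the mandated namespace repeats the single-problem summit's segment (`HodgeConjecture.HodgeConjecture`)
set_option linter.dupNamespace false

noncomputable section

open Matrix Module
open scoped MatrixGroups NNReal
open Literature.NumberTheory.Automorphic ValuativeRel
open Literature.NumberTheory.GaloisRepresentations Literature.NumberTheory.GaloisRepresentations.IsNonarchimedeanLocalField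
open Summit.HodgeConjecture.HodgeConjecture.Cruxes.H413.K2E3GL3PrincipalSeriesExponents
open Summit.HodgeConjecture.HodgeConjecture.Cruxes.H413.K2E3JacquetExponentEigenvector
open Summit.HodgeConjecture.HodgeConjecture.Cruxes.H413.K2E3GL3BorelModulus

namespace Summit.HodgeConjecture.HodgeConjecture.Cruxes.H413.K2E3GL3CharacterJacquetExponent

variable {F : Type} [Field F] [ValuativeRel F] [TopologicalSpace F] [IsNonarchimedeanLocalField F] (η : Fˣ →* ℂˣ)

/-! ## §1 `ker (η ∘ det)` is open; `ρ_η = η ∘ det` is admissible -/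

/-- **`ker (η ∘ det) ≤ GL₃(F)` is open** when `ker η ≤ F^×` is (`det` is continuous, Mathlib `Matrix.GeneralLinearGroup.continuous_det`). [cite: Bump1997, §4.5] -/
theorem isOpen_ker_comp_det (hη : IsOpen ((η.ker : Subgroup Fˣ) : Set Fˣ)) :
    IsOpen (((η.comp (Matrix.GeneralLinearGroup.det : GL (Fin 3) F →* Fˣ)).ker : Subgroup (GL (Fin 3) F)) : Set (GL (Fin 3) F)) := by
  haveI : IsTopologicalRing F := inferInstance
  have h : (((η.comp (Matrix.GeneralLinearGroup.det : GL (Fin 3) F →* Fˣ)).ker : Subgroup (GL (Fin 3) F)) : Set (GL (Fin 3) F)) =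
      (Matrix.GeneralLinearGroup.det : GL (Fin 3) F →* Fˣ) ⁻¹' ((η.ker : Subgroup Fˣ) : Set Fˣ) := by
    ext g
    simp only [SetLike.mem_coe, MonoidHom.mem_ker, MonoidHom.coe_comp, Function.comp_apply, Set.mem_preimage]
  rw [h]
  exact hη.preimage Matrix.GeneralLinearGroup.continuous_det

/-- **`ρ_η = η ∘ det` is an admissible representation of `GL₃(F)`** (on the line `ℂ`) when `ker η` is open (★ `isAdmissible_trivial_twist`). [cite: BernsteinZelevinsky1977, §2.3] [cite: Bump1997, §4.5] -/
theorem isAdmissible_twist_det (hη : IsOpen ((η.ker : Subgroup Fˣ) : Set Fˣ)) :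
    ((Representation.trivial ℂ (GL (Fin 3) F) ℂ).twist (η.comp (Matrix.GeneralLinearGroup.det : GL (Fin 3) F →* Fˣ))).IsAdmissible :=
  isAdmissible_trivial_twist (isOpen_ker_comp_det η hη)

omit [ValuativeRel F] [TopologicalSpace F] [IsNonarchimedeanLocalField F] in
/-- `ρ_η(g) z = η(det g) · z`. [cite: Bump1997, §4.5] -/
theorem twist_det_apply (g : GL (Fin 3) F) (z : ℂ) :
    (Representation.trivial ℂ (GL (Fin 3) F) ℂ).twist (η.comp (Matrix.GeneralLinearGroup.det : GL (Fin 3) F →* Fˣ)) g z =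
      ((η (Matrix.GeneralLinearGroup.det g) : ℂˣ) : ℂ) * z := by
  rw [Representation.twist_apply, Representation.trivial_apply, MonoidHom.comp_apply, smul_eq_mul]

/-! ## §2 The inducing character of `I(θ_η)` is `η ∘ det` on `B` -/

omit [ValuativeRel F] [TopologicalSpace F] [IsNonarchimedeanLocalField F] in
/-- The determinant of the `a`-th (1 × 1) diagonal block of `b ∈ B` is the diagonal entry `b_aa`. [cite: Bump1997, §4.2] -/
theorem coe_det_leviProjection (b : ↥(standardParabolicGL F (id : Fin 3 → Fin 3))) (a : Fin 3) :
    ((Matrix.GeneralLinearGroup.det (leviProjection F (id : Fin 3 → Fin 3) b a) : Fˣ) : F) = ((b : GL (Fin 3) F) : Matrix (Fin 3) (Fin 3) F) a a := by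
  rw [det_fin_one_block, leviProjection_apply_coe]

omit [ValuativeRel F] [TopologicalSpace F] [IsNonarchimedeanLocalField F] in
/-- `det b = b₀₀ · b₁₁ · b₂₂` for `b ∈ B`, as units, in terms of the Levi blocks. [cite: Bump1997, §4.2] -/
theorem det_coe_borel_eq_prod_det_leviProjection (b : ↥(standardParabolicGL F (id : Fin 3 → Fin 3))) :
    Matrix.GeneralLinearGroup.det (b : GL (Fin 3) F) =
      Matrix.GeneralLinearGroup.det (leviProjection F (id : Fin 3 → Fin 3) b 0) * Matrix.GeneralLinearGroup.det (leviProjection F (id : Fin 3 → Fin 3) b 1) *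
        Matrix.GeneralLinearGroup.det (leviProjection F (id : Fin 3 → Fin 3) b 2) := by
  apply Units.ext
  rw [Matrix.GeneralLinearGroup.val_det_apply, det_coe_eq_prod_diag, Fin.prod_univ_three, Units.val_mul, Units.val_mul, coe_det_leviProjection,
    coe_det_leviProjection, coe_det_leviProjection]

/-- `ν(x) = ‖x‖` (as a complex number) for the unramified character `ν = unramifiedTwist F 1`. [cite: Zelevinsky1980, §1.1] -/
theorem coe_unramifiedTwist_one_apply (x : Fˣ) :
    (((((unramifiedTwist F 1 : QuasiChar F).toMonoidHom) x : ℂˣ)) : ℂ) = (((normAbs F (x : F) : ℝ≥0) : ℝ) : ℂ) := by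
  change ((unramifiedTwist F 1 x : ℂˣ) : ℂ) = _
  rw [unramifiedTwist_apply, Complex.cpow_one]

/-- `‖x‖ ≠ 0` in `ℂ` for `x ∈ F^×`. [cite: Zelevinsky1980, §1.1] -/
theorem coe_normAbs_units_ne_zero (x : Fˣ) : (((normAbs F (x : F) : ℝ≥0) : ℝ) : ℂ) ≠ 0 := by
  exact_mod_cast normAbs_units_ne_zero x

/-- **THE INDUCING CHARACTER OF `I(θ_η)` IS `η ∘ det` ON THE BOREL**: for `b ∈ B`, `tch θ_η (proj b) · δ_B^{1∕2}(b) = η(det b)` with `θ_η = (η ν⁻¹, η, η ν)`: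
`tch θ_η(proj b) = η(b₀₀)‖b₀₀‖⁻¹ · η(b₁₁) · η(b₂₂)‖b₂₂‖`, `δ_B^{1∕2}(b) = ‖b₀₀‖‖b₂₂‖⁻¹` (★ `rootDeltaChar_borel_three`) and `det b = b₀₀b₁₁b₂₂`.
[cite: BernsteinZelevinsky1977, §2.3] [cite: Zelevinsky1980, Ex. 3.2] [cite: Bump1997, §4.2 (2.2)–(2.3)] -/
theorem tch_shift_leviProjection_mul_rootDeltaChar (b : ↥(standardParabolicGL F (id : Fin 3 → Fin 3))) :
    (∏ a : Fin 3, ((![η * ((unramifiedTwist F 1 : QuasiChar F).toMonoidHom)⁻¹, η, η * ((unramifiedTwist F 1 : QuasiChar F).toMonoidHom)] : Fin 3 → (Fˣ →* ℂˣ)) a).comp ((Matrix.GeneralLinearGroup.det : GL {i : Fin 3 // (id : Fin 3 → Fin 3) i = a} F →* Fˣ).comp (Pi.evalMonoidHom (fun b : Fin 3 => GL {i : Fin 3 // (id : Fin 3 → Fin 3) i = b} F) a))) (leviProjection F (id : Fin 3 → Fin 3) b) * rootDeltaChar (standardParabolicGL F (id : Fin 3 → Fin 3)) b =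
      η (Matrix.GeneralLinearGroup.det (b : GL (Fin 3) F)) := by
  apply Units.ext
  have h0 := coe_normAbs_units_ne_zero (Matrix.GeneralLinearGroup.det (leviProjection F (id : Fin 3 → Fin 3) b 0))
  have h2 := coe_normAbs_units_ne_zero (Matrix.GeneralLinearGroup.det (leviProjection F (id : Fin 3 → Fin 3) b 2))
  rw [det_coe_borel_eq_prod_det_leviProjection, Units.val_mul, rootDeltaChar_borel_three, ← coe_det_leviProjection b 0, ← coe_det_leviProjection b 2,
    MonoidHom.finsetProd_apply, Fin.prod_univ_three]
  simp only [MonoidHom.coe_comp, Function.comp_apply, Pi.evalMonoidHom_apply, Matrix.cons_val_zero, Matrix.cons_val_one, Matrix.cons_val_two,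
    Matrix.head_cons, Matrix.tail_cons, MonoidHom.mul_apply, MonoidHom.inv_apply, Units.val_mul, Units.val_inv_eq_inv_val, map_mul,
    coe_unramifiedTwist_one_apply, NNReal.coe_mul, NNReal.coe_inv, Complex.ofReal_mul, Complex.ofReal_inv]
  field_simp

/-- **`η ∘ det` is trivial on the unipotent radical `U_B`** (`proj u = 1`, `δ_B^{1∕2}(u) = 1` ★, and §2). [cite: BernsteinZelevinsky1977, §2.3] -/
theorem eta_det_eq_one_of_mem_unipotentRadicalP {u : ↥(standardParabolicGL F (id : Fin 3 → Fin 3))} (hu : u ∈ unipotentRadicalP F (id : Fin 3 → Fin 3)) :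
    η (Matrix.GeneralLinearGroup.det (u : GL (Fin 3) F)) = 1 := by
  rw [← tch_shift_leviProjection_mul_rootDeltaChar η u, (MonoidHom.mem_ker).1 hu, map_one, rootDeltaChar_eq_one_of_mem_unipotentRadicalP F (id : Fin 3 → Fin 3) hu, mul_one]

/-! ## §3 The Jacquet module of `ρ_η`: a line with normalised exponent `tch θ_η` -/

/-- **`U_B` acts trivially on `ρ_η`**: `ρ_η(u) z = z` for `u ∈ U_B` (`η(det u) = 1`, §2). [cite: BernsteinZelevinsky1977, §2.3] -/
theorem restrictUnipotentGL_twist_det_apply (u : ↥(unipotentRadicalP F (id : Fin 3 → Fin 3))) (z : ℂ) :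
    Representation.restrictUnipotentGL F (id : Fin 3 → Fin 3) ((Representation.trivial ℂ (GL (Fin 3) F) ℂ).twist (η.comp (Matrix.GeneralLinearGroup.det : GL (Fin 3) F →* Fˣ))) u z = z := by
  show ((Representation.trivial ℂ (GL (Fin 3) F) ℂ).twist (η.comp (Matrix.GeneralLinearGroup.det : GL (Fin 3) F →* Fˣ))) (((u : ↥(standardParabolicGL F (id : Fin 3 → Fin 3))) : GL (Fin 3) F)) z = z
  rw [twist_det_apply, eta_det_eq_one_of_mem_unipotentRadicalP η u.2, Units.val_one, one_mul]

/-- The coinvariant kernel of `ρ_η|_{U_B}` is zero (all generators `ρ(u)z − z` vanish). [cite: BernsteinZelevinsky1977, §2.3] -/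
theorem coinvariantsKer_twist_det_eq_bot :
    Representation.Coinvariants.ker (Representation.restrictUnipotentGL F (id : Fin 3 → Fin 3) ((Representation.trivial ℂ (GL (Fin 3) F) ℂ).twist (η.comp (Matrix.GeneralLinearGroup.det : GL (Fin 3) F →* Fˣ)))) = ⊥ := by
  rw [Representation.Coinvariants.ker, Submodule.span_eq_bot]
  rintro _ ⟨⟨u, z⟩, rfl⟩
  exact sub_eq_zero.2 (restrictUnipotentGL_twist_det_apply η u z)

/-- **`r_B ρ_η` is a line**: it is finite-dimensional of dimension `1` (`Coinvariants.mk : ℂ → r_B ρ_η` is an isomorphism). [cite: BernsteinZelevinsky1977, §2.3, 2.12] [cite: Casselman1995, §6.3] -/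
theorem finrank_coinvariants_twist_det :
    FiniteDimensional ℂ (Representation.restrictUnipotentGL F (id : Fin 3 → Fin 3) ((Representation.trivial ℂ (GL (Fin 3) F) ℂ).twist (η.comp (Matrix.GeneralLinearGroup.det : GL (Fin 3) F →* Fˣ)))).Coinvariants ∧
      finrank ℂ (Representation.restrictUnipotentGL F (id : Fin 3 → Fin 3) ((Representation.trivial ℂ (GL (Fin 3) F) ℂ).twist (η.comp (Matrix.GeneralLinearGroup.det : GL (Fin 3) F →* Fˣ)))).Coinvariants = 1 := by
  refine ⟨inferInstance, ?_⟩
  have e : (Representation.restrictUnipotentGL F (id : Fin 3 → Fin 3) ((Representation.trivial ℂ (GL (Fin 3) F) ℂ).twist (η.comp (Matrix.GeneralLinearGroup.det : GL (Fin 3) F →* Fˣ)))).Coinvariants ≃ₗ[ℂ] ℂ :=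
    Submodule.quotEquivOfEqBot _ (coinvariantsKer_twist_det_eq_bot η)
  rw [e.finrank_eq, Module.finrank_self]

/-- **THE NORMALISED JACQUET ACTION ON `r_B ρ_η = ℂ` IS THE CHARACTER `tch θ_η`**: `m · [z] = δ_B^{-1∕2}(diag m) η(det diag m) [z] = tch θ_η(m) [z]` (★ `normalizedJacquetGL_mk` and §2 at
`b = diag m`). [cite: BernsteinZelevinsky1977, §2.3, 2.12] [cite: Zelevinsky1980, Ex. 3.2] -/
theorem normalizedJacquetGL_twist_det_mk (m : (Π a : Fin 3, GL {i : Fin 3 // (id : Fin 3 → Fin 3) i = a} F)) (z : ℂ) :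
    Representation.normalizedJacquetGL F (id : Fin 3 → Fin 3) ((Representation.trivial ℂ (GL (Fin 3) F) ℂ).twist (η.comp (Matrix.GeneralLinearGroup.det : GL (Fin 3) F →* Fˣ))) m
        (Representation.Coinvariants.mk (Representation.restrictUnipotentGL F (id : Fin 3 → Fin 3) ((Representation.trivial ℂ (GL (Fin 3) F) ℂ).twist (η.comp (Matrix.GeneralLinearGroup.det : GL (Fin 3) F →* Fˣ)))) z) =
      (((∏ a : Fin 3, ((![η * ((unramifiedTwist F 1 : QuasiChar F).toMonoidHom)⁻¹, η, η * ((unramifiedTwist F 1 : QuasiChar F).toMonoidHom)] : Fin 3 → (Fˣ →* ℂˣ)) a).comp ((Matrix.GeneralLinearGroup.det : GL {i : Fin 3 // (id : Fin 3 → Fin 3) i = a} F →* Fˣ).comp (Pi.evalMonoidHom (fun b : Fin 3 => GL {i : Fin 3 // (id : Fin 3 → Fin 3) i = b} F) a))) m : ℂˣ) : ℂ) • Representation.Coinvariants.mk (Representation.restrictUnipotentGL F (id : Fin 3 → Fin 3) ((Representation.trivial ℂ (GL (Fin 3) F) ℂ).twist (η.comp (Matrix.GeneralLinearGroup.det : GL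 (Fin 3) F →* Fˣ)))) z := by
  rw [Representation.normalizedJacquetGL_mk, twist_det_apply, ← smul_eq_mul, map_smul, smul_smul, ← Units.val_mul]
  congr 2
  have h := tch_shift_leviProjection_mul_rootDeltaChar η (leviEmbeddingP F (id : Fin 3 → Fin 3) m)
  rw [leviProjection_leviEmbeddingP_apply, coe_leviEmbeddingP] at h
  rw [← h, mul_comm, mul_inv_cancel_right]

/-- **`mult ρ_η ζ = [ζ = ⇑tch θ_η]`**: the normalised Jacquet module of `ρ_η = η ∘ det` has the single exponent `tch(η ν⁻¹, η, η ν)`, with multiplicity one (★ E1b one-dimensional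
weight spaces, §3). [cite: BernsteinZelevinsky1977, 2.12] [cite: Zelevinsky1980, §1.1, Ex. 3.2] [cite: Casselman1995, §6.3] -/
theorem finrank_weightSpace_twist_det (ζ : (Π a : Fin 3, GL {i : Fin 3 // (id : Fin 3 → Fin 3) i = a} F) → ℂ) [Decidable (ζ = fun m => (((∏ a : Fin 3, ((![η * ((unramifiedTwist F 1 : QuasiChar F).toMonoidHom)⁻¹, η, η * ((unramifiedTwist F 1 : QuasiChar F).toMonoidHom)] : Fin 3 → (Fˣ →* ℂˣ)) a).comp ((Matrix.GeneralLinearGroup.det : GL {i : Fin 3 // (id : Fin 3 → Fin 3) i = a} F →* Fˣ).comp (Pi.evalMonoidHom (fun b : Fin 3 => GL {i : Fin 3 // (id : Fin 3 → Fin 3) i = b} F) a))) m : ℂˣ) : ℂ))] :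
    finrank ℂ ↥(⨅ m, Module.End.maxGenEigenspace (Representation.normalizedJacquetGL F (id : Fin 3 → Fin 3) ((Representation.trivial ℂ (GL (Fin 3) F) ℂ).twist (η.comp (Matrix.GeneralLinearGroup.det : GL (Fin 3) F →* Fˣ))) m) (ζ m)) =
      if ζ = (fun m => (((∏ a : Fin 3, ((![η * ((unramifiedTwist F 1 : QuasiChar F).toMonoidHom)⁻¹, η, η * ((unramifiedTwist F 1 : QuasiChar F).toMonoidHom)] : Fin 3 → (Fˣ →* ℂˣ)) a).comp ((Matrix.GeneralLinearGroup.det : GL {i : Fin 3 // (id : Fin 3 → Fin 3) i = a} F →* Fˣ).comp (Pi.evalMonoidHom (fun b : Fin 3 => GL {i : Fin 3 // (id : Fin 3 → Fin 3) i = b} F) a))) m : ℂˣ) : ℂ)) then 1 else 0 := by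
  haveI := (finrank_coinvariants_twist_det η).1
  have hτ : ∀ (m : (Π a : Fin 3, GL {i : Fin 3 // (id : Fin 3 → Fin 3) i = a} F)) (v : (Representation.restrictUnipotentGL F (id : Fin 3 → Fin 3) ((Representation.trivial ℂ (GL (Fin 3) F) ℂ).twist (η.comp (Matrix.GeneralLinearGroup.det : GL (Fin 3) F →* Fˣ)))).Coinvariants),
      Representation.normalizedJacquetGL F (id : Fin 3 → Fin 3) ((Representation.trivial ℂ (GL (Fin 3) F) ℂ).twist (η.comp (Matrix.GeneralLinearGroup.det : GL (Fin 3) F →* Fˣ))) m v = (fun m => (((∏ a : Fin 3, ((![η * ((unramifiedTwist F 1 : QuasiChar F).toMonoidHom)⁻¹, η, η * ((unramifiedTwist F 1 : QuasiChar F).toMonoidHom)] : Fin 3 → (Fˣ →* ℂˣ)) a).comp ((Matrix.GeneralLinearGroup.det : GL {i : Fin 3 // (id : Fin 3 → Fin 3) i = a} F →* Fˣ).comp (Pi.evalMonoidHom (fun b : Fin 3 => GL {i : Fin 3 // (id : Fin 3 → Fin 3) i = b} F) a))) m : ℂˣ) : ℂ)) m • v := by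
    intro m v
    obtain ⟨z, rfl⟩ := Representation.Coinvariants.mk_surjective _ v
    exact normalizedJacquetGL_twist_det_mk η m z
  split_ifs with h
  · subst h
    rw [weightSpace_eq_top_of_forall_apply_eq_smul _ _ hτ, finrank_top, (finrank_coinvariants_twist_det η).2]
  · rw [weightSpace_eq_bot_of_forall_apply_eq_smul_of_ne _ _ hτ h, finrank_bot]

/-! ## §4 The embedding `ρ_η ↪ I(θ_η)` -/

/-- **`ρ_η = η ∘ det` EMBEDS INTO THE PRINCIPAL SERIES `I(η ν⁻¹, η, η ν)`**: the identity `ℂ → ℂ` is a `B`-map from `ρ_η|_B` to the inducing character `σ_{θ_η} = (tch θ_η ∘ proj) · δ_B^{1∕2}`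
(§2), and Frobenius reciprocity (★ `Representation.frobeniusInv`, `(Φ z)(g) = η(det g) z`) turns it into an intertwining map `Φ : ρ_η → I θ_η`, injective by evaluation at `1`.
[cite: BernsteinZelevinsky1977, §2.3 (Frobenius reciprocity)] [cite: Casselman1995, §3.1, §6.3] [cite: Bump1997, Prop. 4.5.1] -/
theorem exists_injective_intertwiningMap_twist_det (hη : IsOpen ((η.ker : Subgroup Fˣ) : Set Fˣ)) :
    ∃ Φ : Representation.IntertwiningMap ((Representation.trivial ℂ (GL (Fin 3) F) ℂ).twist (η.comp (Matrix.GeneralLinearGroup.det : GL (Fin 3) F →* Fˣ)))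
        (Representation.parabolicIndGL F (id : Fin 3 → Fin 3) ((Representation.trivial ℂ (Π a : Fin 3, GL {i : Fin 3 // (id : Fin 3 → Fin 3) i = a} F) ℂ).twist (∏ a : Fin 3, ((![η * ((unramifiedTwist F 1 : QuasiChar F).toMonoidHom)⁻¹, η, η * ((unramifiedTwist F 1 : QuasiChar F).toMonoidHom)] : Fin 3 → (Fˣ →* ℂˣ)) a).comp ((Matrix.GeneralLinearGroup.det : GL {i : Fin 3 // (id : Fin 3 → Fin 3) i = a} F →* Fˣ).comp (Pi.evalMonoidHom (fun b : Fin 3 => GL {i : Fin 3 // (id : Fin 3 → Fin 3) i = b} F) a))))),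
      Function.Injective Φ := by
  have hsm : Representation.IsSmooth ((Representation.trivial ℂ (GL (Fin 3) F) ℂ).twist (η.comp (Matrix.GeneralLinearGroup.det : GL (Fin 3) F →* Fˣ))) := (isAdmissible_twist_det η hη).1
  -- the identity is a `B`-map `ρ_η|_B → σ_θ`
  have hφ : ∀ (b : ↥(standardParabolicGL F (id : Fin 3 → Fin 3))) (z : ℂ),
      (LinearMap.id : ℂ →ₗ[ℂ] ℂ) ((((Representation.trivial ℂ (GL (Fin 3) F) ℂ).twist (η.comp (Matrix.GeneralLinearGroup.det : GL (Fin 3) F →* Fˣ)))).comp (standardParabolicGL F (id : Fin 3 → Fin 3)).subtype b z) =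
        (Representation.twist ((((Representation.trivial ℂ (Π a : Fin 3, GL {i : Fin 3 // (id : Fin 3 → Fin 3) i = a} F) ℂ).twist (∏ a : Fin 3, ((![η * ((unramifiedTwist F 1 : QuasiChar F).toMonoidHom)⁻¹, η, η * ((unramifiedTwist F 1 : QuasiChar F).toMonoidHom)] : Fin 3 → (Fˣ →* ℂˣ)) a).comp ((Matrix.GeneralLinearGroup.det : GL {i : Fin 3 // (id : Fin 3 → Fin 3) i = a} F →* Fˣ).comp (Pi.evalMonoidHom (fun b : Fin 3 => GL {i : Fin 3 // (id : Fin 3 → Fin 3) i = b} F) a))))).comp (leviProjection F (id : Fin 3 → Fin 3))) (rootDeltaChar (standardParabolicGL F (id : Fin 3 → Fin 3)))) b ((LinearMap.id : ℂ →ₗ[ℂ] ℂ) z) := by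
    intro b z
    rw [LinearMap.id_apply, LinearMap.id_apply, MonoidHom.comp_apply, Subgroup.coe_subtype, twist_det_apply, Representation.twist_apply,
      MonoidHom.comp_apply, Representation.twist_apply, Representation.trivial_apply, smul_eq_mul, smul_eq_mul, ← mul_assoc,
      ← Units.val_mul, mul_comm (rootDeltaChar _ b), tch_shift_leviProjection_mul_rootDeltaChar η b]
  let φ : Representation.IntertwiningMap ((((Representation.trivial ℂ (GL (Fin 3) F) ℂ).twist (η.comp (Matrix.GeneralLinearGroup.det : GL (Fin 3) F →* Fˣ)))).comp (standardParabolicGL F (id : Fin 3 → Fin 3)).subtype) (Representation.twist ((((Representation.trivial ℂ (Π a : Fin 3, GL {i : Fin 3 // (id : Fin 3 → Fin 3) i = a} F) ℂ).twist (∏ a : Fin 3, ((![η * ((unramifiedTwist F 1 : QuasiChar F).toMonoidHom)⁻¹, η, η * ((unramifiedTwist F 1 : QuasiChar F).toMonoidHom)] : Fin 3 → (Fˣ →* ℂˣ)) a).comp ((Matrix.GeneralLinearGroup.det : GL {i : Fin 3 // (id : Fin 3 → Fin 3) i = a} F →* Fˣ).comp (Pi.evalMonoidHom (fun b : Fin 3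 => GL {i : Fin 3 // (id : Fin 3 → Fin 3) i = b} F) a))))).comp (leviProjection F (id : Fin 3 → Fin 3))) (rootDeltaChar (standardParabolicGL F (id : Fin 3 → Fin 3)))) :=
    LinearMap.intertwiningMap_of_isIntertwiningMap _ _ _ hφ
  have hev : ∀ v : ℂ, (Representation.frobeniusInv hsm φ v).toFun 1 = v := fun v => by
    rw [Representation.toFun_frobeniusInv_apply, map_one, Module.End.one_apply]
    rfl
  refine ⟨Representation.frobeniusInv hsm φ, fun v w hvw => ?_⟩
  have h := congrArg (fun f => Representation.SmoothInd.toFun f 1) hvw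
  exact (hev v).symm.trans (h.trans (hev w))

end Summit.HodgeConjecture.HodgeConjecture.Cruxes.H413.K2E3GL3CharacterJacquetExponent

end
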